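import Summits.ResolutionOfSingularities.ResolutionOfSingularities.Theorems.UniversalCellsCampaignW82SelectionGraded
import Summits.ResolutionOfSingularities.ResolutionOfSingularities.Theorems.UniversalCellsCampaignW82SelectionNecessary
import Summits.ResolutionOfSingularities.ResolutionOfSingularities.Theorems.UniversalCellsCampaignW82ExponentZeroAnyField
import HarnessLib

/-!
# [OURS · L1 W8.2] The blind re-resolution form is FALSE at every constant field of characteristic `p` — proofs
# against Theorems/UniversalCellsCampaignW82SelectionGraded.lean

Cell `res-hironaka`, LADDER-RESOLUTION rung L, slot W8.2 (host `UniversalCells.PrimeFieldToPerfect`, stmt-15233). Proofs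
(Theses-free) by res-L1-s82-pv-1 (gen 3): `not_resolutionsOfSmoothAreSmooth p k : ¬ ResolutionsOfSmoothAreSmooth k` for
every prime `p` and every field `k` of characteristic `p`, by `SelectionWitness.exists_resolution_of_smooth_not_smooth`
(the blow-up of the plane at the inseparable closed point `(Y, X^p − t)` is a resolution of the smooth plane and is not
smooth); door-1 / door-2 shapes `not_forall_perfect_…`, `not_forall_isAlgClosed_…`. Honest grade: a tightness certificate
(STRATEGY-CENSUS N2 / Disproof §4 (s5)); nothing here bears on the open residual `PerfectionStepAt M n`, `n ≥ 4`. OURS;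
NOT statements of H. Hironaka's manuscript [Hironaka2017]; AI work, weaker than expert review.
-/

noncomputable section

set_option linter.dupNamespace false -- mandated namespace of this single-conjunct summit

open _root_.CategoryTheory _root_.CategoryTheory.Limits _root_.AlgebraicGeometry
open Literature.AlgebraicGeometry.Resolution

namespace Summit.ResolutionOfSingularities.ResolutionOfSingularities.Theorems.CampaignW82

/-- **`¬ ResolutionsOfSmoothAreSmooth k` for every field `k` of characteristic `p`** — the W8.2 residual's smooth
model must be SELECTED: over `k(t)` the plane is smooth, its blow-up at `(Y, X^p − t)` is a resolution of
singularities, and that blow-up is not smooth over `k(t)` (`SelectionWitness.exists_resolution_of_smooth_not_smooth`).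
[folklore] -/
theorem not_resolutionsOfSmoothAreSmooth (p : ℕ) [Fact p.Prime] (k : Type) [Field k] [CharP k p] :
    ¬ ResolutionsOfSmoothAreSmooth k := by
  intro h
  obtain ⟨X₀, X₁, f₀, π, hsm, hsep, hloft, hqc, -, hres, hns⟩ :=
    SelectionWitness.exists_resolution_of_smooth_not_smooth k p
  exact hns (h X₀ f₀ hsep hloft hqc hsm X₁ π hres)

/-- Door-1 shape: no universally quantified version over perfect constant fields survives (witness `𝔽_p`). [folklore] -/
theorem not_forall_perfect_resolutionsOfSmoothAreSmooth (p : ℕ) [Fact p.Prime] :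
    ¬ ∀ (M : Type) [Field M] [CharP M p] [PerfectField M], ResolutionsOfSmoothAreSmooth M :=
  fun h => not_resolutionsOfSmoothAreSmooth p (ZMod p) (h (ZMod p))

/-- Door-2 shape: nor over algebraically closed constant fields (witness `(𝔽_p)^{alg}`). [folklore] -/
theorem not_forall_isAlgClosed_resolutionsOfSmoothAreSmooth (p : ℕ) [Fact p.Prime] :
    ¬ ∀ (M : Type) [Field M] [CharP M p] [IsAlgClosed M], ResolutionsOfSmoothAreSmooth M :=
  fun h => not_resolutionsOfSmoothAreSmooth p (AlgebraicClosure (ZMod p)) (h (AlgebraicClosure (ZMod p)))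

/-- **Both existentials of the residual's normal form are load-bearing, at every constant field of characteristic
`p`** (juxtaposition of the two tightness certificates of this seat): the exponent (`¬ SmoothModelStepRegularAt k 1`)
and the choice of the model (`¬ ResolutionsOfSmoothAreSmooth k`). [folklore] -/
theorem not_smoothModelStepRegularAt_one_and_not_resolutionsOfSmoothAreSmooth (p : ℕ) [Fact p.Prime] (k : Type)
    [Field k] [CharP k p] : ¬ SmoothModelStepRegularAt k 1 ∧ ¬ ResolutionsOfSmoothAreSmooth k :=
  ⟨not_smoothModelStepRegularAt_one p k, not_resolutionsOfSmoothAreSmooth p k⟩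

end Summit.ResolutionOfSingularities.ResolutionOfSingularities.Theorems.CampaignW82

end
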